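import Summits.QuantumFields.BalabanUV.Beta.SubsolutionMeanValue

/-!
# Beta / SubsolutionCaccioppoli — THE DISCRETE CACCIOPPOLI INEQUALITY FOR NONNEGATIVE SUB-SOLUTIONS OF THE FREE WEIGHTED GRAPH
# LAPLACIAN, the level truncation `(z − k)₊` and Chebyshev's count — the three elementary bricks of De Giorgi's iteration on a finite
# bond structure (generic carrier, as `SubsolutionMeanValue`; second module of the chain «LATTICE-DEGIORGI-MV»)

SETTING (the syntactic shape of files 12 ∕ 14 ∕ `SubsolutionMeanValue`, so that hypotheses pass by `exact`): a finite bond structure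
`src, tgt : Bd → St` with weights `c : Bd → ℝ`; `W(x) = Σ_{b : tgt b = x} c_b² + Σ_{b : src b = x} c_b²`,
`(Nu)(x) = Σ_{b : tgt b = x} c_b²·u(src b) + Σ_{b : src b = x} c_b²·u(tgt b)`, a SUB-SOLUTION on a set is `W·u ≤ Nu` there, and the Dirichlet
energy is `E(f) = Σ_b c_b²·(f(tgt b) − f(src b))²`.
CONTENT (kernel, 0 sorry): §1 **summation by parts** `Σ_x g(x)·(W(x)v(x) − (Nv)(x)) = Σ_b c_b²·(g(b₊) − g(b₋))·(v(b₊) − v(b₋))`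
(`Finset.sum_fiberwise`); §2 **level truncation**: a sub-solution minus a constant is one, and `(z − k)₊` of a sub-solution is a NONNEGATIVE
sub-solution (`SubsolutionMeanValue.posPart_subsolution`); §3 the per-bond polynomial inequality
`3(sa − tb)² ≤ 16(s²a − t²b)(a − b) + 38(s − t)²(a² + b²)` (all reals) and **`caccioppoli`**: for `η ≥ 0`, `v ≥ 0` and `v` a sub-solution wherever
`η ≠ 0`, `E(ηv) ≤ 13·Σ_b c_b²(η(b₊) − η(b₋))²(v(b₊)² + v(b₋)²)` (testing `Σ_x η²v·(Wv − Nv) ≤ 0`); §4 **`caccioppoli_cutoff`**: if moreover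
`|η(b₊) − η(b₋)| ≤ 1/ρ` on every bond and the bonds where `η` jumps have both ends in `D`, `E(ηv) ≤ (13/ρ²)·Σ_{x ∈ D} W(x)v(x)²`;
§5 **Chebyshev** `#{x ∈ S : μ < v x}·μ² ≤ Σ_S v²` (`μ > 0`, `v ≥ 0`).
(unit `b2b-balaban-beta-d4-p2`, GEN 10, MODEL crew; claim «LATTICE-DEGIORGI-MV» journal l.22396; consumer: `DeGiorgiIteration` on torus boxes.)

HONEST FRAMING: discharging `BetaPertH` makes Bałaban's UV stability UNCONDITIONAL — NOT the continuum limit, NOT the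
Clay problem.  HONEST DEPENDENCY (verbatim): «continuum YM on T⁴ ⇐ BetaPertH ∧ nine spine estimates (0/9 proved);
BetaPertH ⇐ (D1) ∧ (D4) ∧ CAP+tail; G-an2-4 gates asym, D1 and NE2/3/4.»  THIS MODULE DISCHARGES NOTHING of `BetaPertH`,
asserts NOTHING printed and cites nothing as a fact (ABSOLUTE RULE): [folklore] finite order ∕ energy bookkeeping (method pointer only:
Delmotte, Colloq. Math. 72 (1997) Lemme 5.1 — Caccioppoli on graphs).  No class change on row D4 (critical-path width 0; D4 DISCHARGE NO
DATE); NOT BetaPertH, NOT continuum, NOT Clay, NOT summit progress.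
-/

open scoped BigOperators
open Finset

namespace Summit.QuantumFields.BalabanUV.Beta.SubsolutionCaccioppoli

open Summit.QuantumFields.BalabanUV.Beta.SubsolutionMeanValue (nb_mono nb_nonneg posPart_subsolution)

noncomputable section

variable {St Bd : Type} [Fintype St] [Fintype Bd] [DecidableEq St] (src tgt : Bd → St) (c : Bd → ℝ)

/-! ## §1 Summation by parts -/

/-- Fibrewise regrouping over targets: `Σ_x g(x)·Σ_{tgt b = x} F(b) = Σ_b g(tgt b)·F(b)`. [folklore] -/
theorem sum_mul_sum_tgt (g : St → ℝ) (F : Bd → ℝ) :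
    ∑ x, g x * ∑ b ∈ univ.filter (fun b => tgt b = x), F b = ∑ b, g (tgt b) * F b := by
  rw [← Finset.sum_fiberwise (s := (univ : Finset Bd)) (g := tgt) (f := fun b => g (tgt b) * F b)]
  refine Finset.sum_congr rfl fun x _ => ?_
  rw [Finset.mul_sum]
  refine Finset.sum_congr rfl fun b hb => ?_
  rw [(Finset.mem_filter.mp hb).2]

/-- Fibrewise regrouping over sources: `Σ_x g(x)·Σ_{src b = x} F(b) = Σ_b g(src b)·F(b)`. [folklore] -/
theorem sum_mul_sum_src (g : St → ℝ) (F : Bd → ℝ) :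
    ∑ x, g x * ∑ b ∈ univ.filter (fun b => src b = x), F b = ∑ b, g (src b) * F b := by
  rw [← Finset.sum_fiberwise (s := (univ : Finset Bd)) (g := src) (f := fun b => g (src b) * F b)]
  refine Finset.sum_congr rfl fun x _ => ?_
  rw [Finset.mul_sum]
  refine Finset.sum_congr rfl fun b hb => ?_
  rw [(Finset.mem_filter.mp hb).2]

/-- **SUMMATION BY PARTS for the free weighted graph Laplacian**:
`Σ_x g(x)·(W(x)·v(x) − (Nv)(x)) = Σ_b c_b²·(g(tgt b) − g(src b))·(v(tgt b) − v(src b))`. [folklore] -/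
theorem sum_mul_lap_eq (g v : St → ℝ) :
    ∑ x, g x * (((∑ b ∈ univ.filter (fun b => tgt b = x), c b ^ 2) + ∑ b ∈ univ.filter (fun b => src b = x), c b ^ 2) * v x -
        ((∑ b ∈ univ.filter (fun b => tgt b = x), c b ^ 2 * v (src b)) + ∑ b ∈ univ.filter (fun b => src b = x), c b ^ 2 * v (tgt b))) =
      ∑ b, c b ^ 2 * (g (tgt b) - g (src b)) * (v (tgt b) - v (src b)) := by
  have h1 : ∀ x, g x * (((∑ b ∈ univ.filter (fun b => tgt b = x), c b ^ 2) + ∑ b ∈ univ.filter (fun b => src b = x), c b ^ 2) * v x -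
      ((∑ b ∈ univ.filter (fun b => tgt b = x), c b ^ 2 * v (src b)) + ∑ b ∈ univ.filter (fun b => src b = x), c b ^ 2 * v (tgt b))) =
      (g x * v x) * (∑ b ∈ univ.filter (fun b => tgt b = x), c b ^ 2) + (g x * v x) * (∑ b ∈ univ.filter (fun b => src b = x), c b ^ 2) -
        g x * (∑ b ∈ univ.filter (fun b => tgt b = x), c b ^ 2 * v (src b)) - g x * (∑ b ∈ univ.filter (fun b => src b = x), c b ^ 2 * v (tgt b)) :=
    fun x => by ring
  simp_rw [h1, Finset.sum_sub_distrib, Finset.sum_add_distrib]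
  rw [sum_mul_sum_tgt tgt (fun x => g x * v x) (fun b => c b ^ 2), sum_mul_sum_src src (fun x => g x * v x) (fun b => c b ^ 2),
    sum_mul_sum_tgt tgt g (fun b => c b ^ 2 * v (src b)), sum_mul_sum_src src g (fun b => c b ^ 2 * v (tgt b)),
    ← Finset.sum_add_distrib, ← Finset.sum_sub_distrib, ← Finset.sum_sub_distrib]
  exact Finset.sum_congr rfl fun b _ => by ring

/-! ## §2 Level truncation -/

omit [Fintype St] in
/-- The neighbour sum of `u − k` is `Nu − k·W`. [folklore] -/
theorem nb_sub_const (u : St → ℝ) (k : ℝ) (x : St) :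
    ((∑ b ∈ univ.filter (fun b => tgt b = x), c b ^ 2 * (u (src b) - k)) +
        ∑ b ∈ univ.filter (fun b => src b = x), c b ^ 2 * (u (tgt b) - k)) =
      ((∑ b ∈ univ.filter (fun b => tgt b = x), c b ^ 2 * u (src b)) + ∑ b ∈ univ.filter (fun b => src b = x), c b ^ 2 * u (tgt b)) -
        k * ((∑ b ∈ univ.filter (fun b => tgt b = x), c b ^ 2) + ∑ b ∈ univ.filter (fun b => src b = x), c b ^ 2) := by
  simp only [mul_sub, Finset.sum_sub_distrib, ← Finset.sum_mul]
  ring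

omit [Fintype St] in
/-- **A sub-solution minus a constant is a sub-solution** (`W·k = N(k)`). [folklore] -/
theorem sub_const_subsolution (B : Finset St) (z : St → ℝ) (k : ℝ)
    (hz : ∀ x ∈ B, ((∑ b ∈ univ.filter (fun b => tgt b = x), c b ^ 2) + ∑ b ∈ univ.filter (fun b => src b = x), c b ^ 2) * z x ≤
      ((∑ b ∈ univ.filter (fun b => tgt b = x), c b ^ 2 * z (src b)) + ∑ b ∈ univ.filter (fun b => src b = x), c b ^ 2 * z (tgt b))) :
    ∀ x ∈ B, ((∑ b ∈ univ.filter (fun b => tgt b = x), c b ^ 2) + ∑ b ∈ univ.filter (fun b => src b = x), c b ^ 2) * (z x - k) ≤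
      ((∑ b ∈ univ.filter (fun b => tgt b = x), c b ^ 2 * (z (src b) - k)) +
        ∑ b ∈ univ.filter (fun b => src b = x), c b ^ 2 * (z (tgt b) - k)) := by
  intro x hx
  rw [nb_sub_const src tgt c z k x, mul_sub]
  have := hz x hx
  linarith

omit [Fintype St] in
/-- **LEVEL TRUNCATION**: for a sub-solution `z` on `B` and any level `k`, `v = (z − k)₊` is a NONNEGATIVE sub-solution on `B` (the maximum
of the two sub-solutions `z − k` and `0`). [folklore] -/
theorem posPart_sub_subsolution (B : Finset St) (z : St → ℝ) (k : ℝ)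
    (hz : ∀ x ∈ B, ((∑ b ∈ univ.filter (fun b => tgt b = x), c b ^ 2) + ∑ b ∈ univ.filter (fun b => src b = x), c b ^ 2) * z x ≤
      ((∑ b ∈ univ.filter (fun b => tgt b = x), c b ^ 2 * z (src b)) + ∑ b ∈ univ.filter (fun b => src b = x), c b ^ 2 * z (tgt b))) :
    ∀ x ∈ B, ((∑ b ∈ univ.filter (fun b => tgt b = x), c b ^ 2) + ∑ b ∈ univ.filter (fun b => src b = x), c b ^ 2) * max (z x - k) 0 ≤
      ((∑ b ∈ univ.filter (fun b => tgt b = x), c b ^ 2 * max (z (src b) - k) 0) +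
        ∑ b ∈ univ.filter (fun b => src b = x), c b ^ 2 * max (z (tgt b) - k) 0) :=
  posPart_subsolution src tgt c B (fun y => z y - k) (sub_const_subsolution src tgt c B z k hz)

/-! ## §3 Caccioppoli -/

omit [Fintype St] [Fintype Bd] [DecidableEq St] in
/-- The per-bond polynomial inequality behind Caccioppoli, valid for ALL reals:
`3(sa − tb)² ≤ 16·(s²a − t²b)(a − b) + 38·(s − t)²(a² + b²)`. [folklore] -/
theorem per_bond (s t a b : ℝ) :
    3 * (s * a - t * b) ^ 2 ≤ 16 * ((s ^ 2 * a - t ^ 2 * b) * (a - b)) + 38 * ((s - t) ^ 2 * (a ^ 2 + b ^ 2)) := by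
  nlinarith [sq_nonneg ((s + t) * (a - b) + 4 * ((s - t) * (a + b))), sq_nonneg (s * (a - b) - b * (s - t)),
    sq_nonneg (t * (a - b)), sq_nonneg (a * (s - t)), sq_nonneg ((s - t) * (a - b)), sq_nonneg ((s - t) * (a + b)),
    sq_nonneg ((s + t) * (a - b))]

/-- **Testing a sub-solution against `η²v` gives a nonpositive pairing**: if `η x ≠ 0 ⟹ (Wv − Nv)(x) ≤ 0` and `v ≥ 0`, then
`Σ_b c_b²·(η(b₊)²v(b₊) − η(b₋)²v(b₋))·(v(b₊) − v(b₋)) ≤ 0`. [folklore] -/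
theorem pairing_nonpos (η v : St → ℝ) (hv : ∀ x, 0 ≤ v x)
    (hsub : ∀ x, η x ≠ 0 → ((∑ b ∈ univ.filter (fun b => tgt b = x), c b ^ 2) + ∑ b ∈ univ.filter (fun b => src b = x), c b ^ 2) * v x ≤
      ((∑ b ∈ univ.filter (fun b => tgt b = x), c b ^ 2 * v (src b)) + ∑ b ∈ univ.filter (fun b => src b = x), c b ^ 2 * v (tgt b))) :
    ∑ b, c b ^ 2 * (η (tgt b) ^ 2 * v (tgt b) - η (src b) ^ 2 * v (src b)) * (v (tgt b) - v (src b)) ≤ 0 := by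
  rw [← sum_mul_lap_eq src tgt c (fun x => η x ^ 2 * v x) v]
  refine Finset.sum_nonpos fun x _ => ?_
  by_cases hη : η x = 0
  · rw [hη]; ring_nf; rfl
  · have h1 := hsub x hη
    have h2 : 0 ≤ η x ^ 2 * v x := mul_nonneg (sq_nonneg _) (hv x)
    exact mul_nonpos_of_nonneg_of_nonpos h2 (by linarith)

/-- **THE DISCRETE CACCIOPPOLI INEQUALITY.**  `η ≥ 0`, `v ≥ 0`, `v` a sub-solution at every site where `η ≠ 0`:
`Σ_b c_b²(η(b₊)v(b₊) − η(b₋)v(b₋))² ≤ 13·Σ_b c_b²(η(b₊) − η(b₋))²(v(b₊)² + v(b₋)²)` — the energy of `ηv` is paid by the mass of `v` on the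
transition region of `η`. [folklore] -/
theorem caccioppoli (η v : St → ℝ) (hv : ∀ x, 0 ≤ v x)
    (hsub : ∀ x, η x ≠ 0 → ((∑ b ∈ univ.filter (fun b => tgt b = x), c b ^ 2) + ∑ b ∈ univ.filter (fun b => src b = x), c b ^ 2) * v x ≤
      ((∑ b ∈ univ.filter (fun b => tgt b = x), c b ^ 2 * v (src b)) + ∑ b ∈ univ.filter (fun b => src b = x), c b ^ 2 * v (tgt b))) :
    ∑ b, c b ^ 2 * (η (tgt b) * v (tgt b) - η (src b) * v (src b)) ^ 2 ≤
      13 * ∑ b, c b ^ 2 * ((η (tgt b) - η (src b)) ^ 2 * (v (tgt b) ^ 2 + v (src b) ^ 2)) := by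
  have hS := pairing_nonpos src tgt c η v hv hsub
  have hpt : ∀ b, 3 * (c b ^ 2 * (η (tgt b) * v (tgt b) - η (src b) * v (src b)) ^ 2) ≤
      16 * (c b ^ 2 * (η (tgt b) ^ 2 * v (tgt b) - η (src b) ^ 2 * v (src b)) * (v (tgt b) - v (src b))) +
        38 * (c b ^ 2 * ((η (tgt b) - η (src b)) ^ 2 * (v (tgt b) ^ 2 + v (src b) ^ 2))) := by
    intro b
    have h := per_bond (η (tgt b)) (η (src b)) (v (tgt b)) (v (src b))
    have hc : 0 ≤ c b ^ 2 := sq_nonneg _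
    nlinarith
  have hsum := Finset.sum_le_sum fun b (_ : b ∈ (univ : Finset Bd)) => hpt b
  rw [← Finset.mul_sum, Finset.sum_add_distrib, ← Finset.mul_sum, ← Finset.mul_sum] at hsum
  have h0 : 0 ≤ ∑ b, c b ^ 2 * ((η (tgt b) - η (src b)) ^ 2 * (v (tgt b) ^ 2 + v (src b) ^ 2)) :=
    Finset.sum_nonneg fun b _ => by positivity
  linarith

/-! ## §4 Caccioppoli with a Lipschitz cutoff -/

/-- Fibrewise: `Σ_b c_b²·1_D(tgt b)·u(tgt b) + Σ_b c_b²·1_D(src b)·u(src b) = Σ_{x ∈ D} W(x)·u(x)`. [folklore] -/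
theorem sum_bond_ends_eq (D : Finset St) (u : St → ℝ) :
    (∑ b, c b ^ 2 * (if tgt b ∈ D then u (tgt b) else 0)) + ∑ b, c b ^ 2 * (if src b ∈ D then u (src b) else 0) =
      ∑ x ∈ D, ((∑ b ∈ univ.filter (fun b => tgt b = x), c b ^ 2) + ∑ b ∈ univ.filter (fun b => src b = x), c b ^ 2) * u x := by
  have h1 := sum_mul_sum_tgt tgt (fun x => if x ∈ D then u x else 0) (fun b => c b ^ 2)
  have h2 := sum_mul_sum_src src (fun x => if x ∈ D then u x else 0) (fun b => c b ^ 2)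
  have e1 : ∑ b, c b ^ 2 * (if tgt b ∈ D then u (tgt b) else 0) = ∑ b, (if tgt b ∈ D then u (tgt b) else 0) * c b ^ 2 :=
    Finset.sum_congr rfl fun b _ => by ring
  have e2 : ∑ b, c b ^ 2 * (if src b ∈ D then u (src b) else 0) = ∑ b, (if src b ∈ D then u (src b) else 0) * c b ^ 2 :=
    Finset.sum_congr rfl fun b _ => by ring
  rw [e1, e2, ← h1, ← h2, ← Finset.sum_add_distrib]
  calc ∑ x, ((if x ∈ D then u x else 0) * (∑ b ∈ univ.filter (fun b => tgt b = x), c b ^ 2) +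
          (if x ∈ D then u x else 0) * ∑ b ∈ univ.filter (fun b => src b = x), c b ^ 2)
      = ∑ x, (if x ∈ D then ((∑ b ∈ univ.filter (fun b => tgt b = x), c b ^ 2) + ∑ b ∈ univ.filter (fun b => src b = x), c b ^ 2) * u x
          else 0) := Finset.sum_congr rfl fun x _ => by split_ifs <;> ring
    _ = ∑ x ∈ univ ∩ D, ((∑ b ∈ univ.filter (fun b => tgt b = x), c b ^ 2) + ∑ b ∈ univ.filter (fun b => src b = x), c b ^ 2) * u x :=
        Finset.sum_ite_mem _ _ _
    _ = ∑ x ∈ D, ((∑ b ∈ univ.filter (fun b => tgt b = x), c b ^ 2) + ∑ b ∈ univ.filter (fun b => src b = x), c b ^ 2) * u x := by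
        rw [Finset.univ_inter]

/-- **CACCIOPPOLI WITH A LIPSCHITZ CUTOFF**: if moreover `|η(b₊) − η(b₋)| ≤ 1/ρ` on every bond and every bond across which `η` changes has
both ends in `D`, then `E(ηv) ≤ (13/ρ²)·Σ_{x ∈ D} W(x)·v(x)²`. [folklore] -/
theorem caccioppoli_cutoff (η v : St → ℝ) (hv : ∀ x, 0 ≤ v x)
    (hsub : ∀ x, η x ≠ 0 → ((∑ b ∈ univ.filter (fun b => tgt b = x), c b ^ 2) + ∑ b ∈ univ.filter (fun b => src b = x), c b ^ 2) * v x ≤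
      ((∑ b ∈ univ.filter (fun b => tgt b = x), c b ^ 2 * v (src b)) + ∑ b ∈ univ.filter (fun b => src b = x), c b ^ 2 * v (tgt b)))
    {ρ : ℝ} (hρ : 0 < ρ) (hlip : ∀ b, |η (tgt b) - η (src b)| ≤ 1 / ρ) (D : Finset St)
    (hD : ∀ b, η (tgt b) ≠ η (src b) → tgt b ∈ D ∧ src b ∈ D) :
    ∑ b, c b ^ 2 * (η (tgt b) * v (tgt b) - η (src b) * v (src b)) ^ 2 ≤
      13 / ρ ^ 2 * ∑ x ∈ D, ((∑ b ∈ univ.filter (fun b => tgt b = x), c b ^ 2) + ∑ b ∈ univ.filter (fun b => src b = x), c b ^ 2) * v x ^ 2 := by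
  have hC := caccioppoli src tgt c η v hv hsub
  -- per bond: (Δη)²(v₊² + v₋²) ≤ ρ⁻²·(1_D(b₊)v₊² + 1_D(b₋)v₋²)
  have hpt : ∀ b, c b ^ 2 * ((η (tgt b) - η (src b)) ^ 2 * (v (tgt b) ^ 2 + v (src b) ^ 2)) ≤
      (1 / ρ ^ 2) * (c b ^ 2 * (if tgt b ∈ D then v (tgt b) ^ 2 else 0) + c b ^ 2 * (if src b ∈ D then v (src b) ^ 2 else 0)) := by
    intro b
    by_cases hj : η (tgt b) = η (src b)
    · rw [hj, sub_self]
      have : 0 ≤ (1 / ρ ^ 2) * (c b ^ 2 * (if tgt b ∈ D then v (tgt b) ^ 2 else 0) + c b ^ 2 * (if src b ∈ D then v (src b) ^ 2 else 0)) := by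
        have h1 : 0 ≤ (if tgt b ∈ D then v (tgt b) ^ 2 else 0) := by split_ifs <;> positivity
        have h2 : 0 ≤ (if src b ∈ D then v (src b) ^ 2 else 0) := by split_ifs <;> positivity
        positivity
      simpa using this
    · obtain ⟨ht, hs⟩ := hD b hj
      rw [if_pos ht, if_pos hs]
      have hsq : (η (tgt b) - η (src b)) ^ 2 ≤ 1 / ρ ^ 2 := by
        have h := hlip b
        have h0 : 0 ≤ |η (tgt b) - η (src b)| := abs_nonneg _
        calc (η (tgt b) - η (src b)) ^ 2 = |η (tgt b) - η (src b)| ^ 2 := (sq_abs _).symm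
          _ ≤ (1 / ρ) ^ 2 := pow_le_pow_left₀ h0 h 2
          _ = 1 / ρ ^ 2 := by rw [one_div, one_div, inv_pow]
      have hc0 : 0 ≤ c b ^ 2 * (v (tgt b) ^ 2 + v (src b) ^ 2) := by positivity
      calc c b ^ 2 * ((η (tgt b) - η (src b)) ^ 2 * (v (tgt b) ^ 2 + v (src b) ^ 2))
          = (η (tgt b) - η (src b)) ^ 2 * (c b ^ 2 * (v (tgt b) ^ 2 + v (src b) ^ 2)) := by ring
        _ ≤ (1 / ρ ^ 2) * (c b ^ 2 * (v (tgt b) ^ 2 + v (src b) ^ 2)) := mul_le_mul_of_nonneg_right hsq hc0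
        _ = (1 / ρ ^ 2) * (c b ^ 2 * v (tgt b) ^ 2 + c b ^ 2 * v (src b) ^ 2) := by ring
  have hsum := Finset.sum_le_sum fun b (_ : b ∈ (univ : Finset Bd)) => hpt b
  rw [← Finset.mul_sum, Finset.sum_add_distrib, sum_bond_ends_eq src tgt c D (fun x => v x ^ 2)] at hsum
  have h13 : (0 : ℝ) ≤ 13 := by norm_num
  calc ∑ b, c b ^ 2 * (η (tgt b) * v (tgt b) - η (src b) * v (src b)) ^ 2
      ≤ 13 * ∑ b, c b ^ 2 * ((η (tgt b) - η (src b)) ^ 2 * (v (tgt b) ^ 2 + v (src b) ^ 2)) := hC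
    _ ≤ 13 * ((1 / ρ ^ 2) *
          ∑ x ∈ D, ((∑ b ∈ univ.filter (fun b => tgt b = x), c b ^ 2) + ∑ b ∈ univ.filter (fun b => src b = x), c b ^ 2) * v x ^ 2) :=
        mul_le_mul_of_nonneg_left hsum h13
    _ = 13 / ρ ^ 2 * ∑ x ∈ D, ((∑ b ∈ univ.filter (fun b => tgt b = x), c b ^ 2) + ∑ b ∈ univ.filter (fun b => src b = x), c b ^ 2) * v x ^ 2 := by
        ring

/-! ## §5 Chebyshev's count -/

omit [Fintype St] [Fintype Bd] [DecidableEq St] in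
/-- **CHEBYSHEV**: `#{x ∈ S : μ < v(x)}·μ² ≤ Σ_{x ∈ S} v(x)²` for `μ > 0`. [folklore] -/
theorem card_filter_mul_sq_le (S : Finset St) (v : St → ℝ) {μ : ℝ} (hμ : 0 < μ) :
    ((S.filter fun x => μ < v x).card : ℝ) * μ ^ 2 ≤ ∑ x ∈ S, v x ^ 2 := by
  classical
  calc ((S.filter fun x => μ < v x).card : ℝ) * μ ^ 2 = ∑ x ∈ S.filter (fun x => μ < v x), μ ^ 2 := by
        rw [Finset.sum_const, nsmul_eq_mul]
    _ ≤ ∑ x ∈ S.filter (fun x => μ < v x), v x ^ 2 := Finset.sum_le_sum fun x hx => by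
        have h := (Finset.mem_filter.mp hx).2
        exact pow_le_pow_left₀ hμ.le h.le 2
    _ ≤ ∑ x ∈ S, v x ^ 2 := Finset.sum_le_sum_of_subset_of_nonneg (Finset.filter_subset _ _) fun x _ _ => sq_nonneg _

end

end Summit.QuantumFields.BalabanUV.Beta.SubsolutionCaccioppoli
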